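import Summits.HodgeConjecture.HodgeConjecture.Theses.NikulinTwinTransport
import Literature.AlgebraicGeometry.Surfaces.K3SurfaceProofs
import Literature.AlgebraicGeometry.Surfaces.K3MarkingProofs
import Literature.AlgebraicGeometry.Surfaces.K3HodgeTypes
import Literature.AlgebraicGeometry.HodgeTheory.HodgeTypeDimension

/-!
# Route NikulinTwinTransport · `TwinSimilitudeAlgebraic` (stmt-HodgeConjecture-13674) —
# maps `η⁻¹ ∘ ρ ∘ η'` induced between marked K3 surfaces by rational similitudes `ρ` of `Λ_ℂ`

Lemmas for the Buskin transfer of the target X = Sim₂(K3) (file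
`NikulinTwinTransportTwinSimilitudeAlgebraicTransfer`): for K3 surfaces `S, S'` with markings
`η : H²(S(ℂ); ℂ) ≅ Λ_ℂ`, `η'` (integral classes `↔ Λ = ℤ²²`, cup product `=` K3 form times an integral
generator of `H⁴`, a `(2,0)`-class `η⁻¹ x` spanning `H^{2,0}` — the shapes of the tree's named facts
`Huybrechts_K3_marking_exists` / `Huybrechts_K3_periodSurjective_projective`) and a `ℂ`-linear
`ρ : Λ_ℂ → Λ_ℂ` DEFINED OVER `ℚ` multiplying the K3 form by `r ≠ 0` and carrying the period of `S'`
into the period line of `S`, the map `η⁻¹ ∘ ρ ∘ η' : H²(S'(ℂ); ℂ) → H²(S(ℂ); ℂ)` is rational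
(`isRationalClass_markingConj`), multiplies cup products by `r` (`cupProduct_markingConj`), and
preserves EVERY Hodge type `(i, j)` (`isOfHodgeType_markingConj`, granted the named fact
`Huybrechts_K3_hodgeTypes_H2`: `H^{2,0} = ℂσ`, `H^{0,2} = ℂσ̄`, `H^{1,1} = ⟨σ, σ̄⟩^⊥`; the types with
`i + j ≠ 2` carry only `0`, `isOfHodgeType_eq_zero_of_add_ne`). Ingredients proved here: markings
are real (`conjClass_marking_symm`: `conj (η⁻¹ z) = η⁻¹ z̄`, the integral basis being fixed by
conjugation), endomorphisms of `Λ_ℂ` defined over `ℚ` are real (`ratEnd_star`) and closed under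
composition (`ratEnd_mul`), the integral generator of `H⁴` of a K3 surface is non-zero
(`generator_ne_zero`, from `IsK3Surface.exists_isIntegralClass_generator_H4`), the period of a twin
is a projective period point (`periodPt_twin`: the hypotheses of the surjectivity fact pass through
a rational `½`-similitude), and the multiplier bookkeeping with signs
(`k3Form_markingConj_signed_mul`, the `r`-version of `k3Form_markingConj_signed`).
Sources: Buskin 2019 §6.2 (proof of Thm. 1.1, "inducing via markings `η, η'` an isometry
`ϕ : Λ_ℚ → Λ_ℚ`"); Huybrechts, *Lectures on K3 Surfaces*, Ch. 6 Prop. 1.2 and Rem. 3.3.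
-/

noncomputable section

open CategoryTheory MonoidalCategory
open Literature.AlgebraicGeometry.Motives Literature.AlgebraicGeometry.HodgeTheory
open Literature.AlgebraicGeometry.Surfaces
open Literature.AlgebraicTopology.SingularHomology

namespace Summit.HodgeConjecture.HodgeConjecture.Theorems.NikulinTwinTransport

/-! ### Generic lemmas: Hodge types, conjugation, rational endomorphisms of `Λ_ℂ` -/

/-- A class of Hodge type `(p, q)` with `p + q ≠ k` is zero: there are no `k`-forms of type
`(p, q)` (`hodgePQ_eq_bot_of_ne`), and the pull-back to a Hodge model is injective. [folklore] -/
theorem isOfHodgeType_eq_zero_of_add_ne {n : ℕ} {X : SchemeOver ℂ} {k p q : ℕ}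
    {c : complexBetti X k} (hc : IsOfHodgeType n X k p q c) (h : p + q ≠ k) : c = 0 := by
  obtain ⟨A, hA⟩ := hc
  rw [(A.hodgePQ_eq_bot_iff k p q).2
      (Literature.NumberTheory.Transcendental.hodgePQ_eq_bot_of_ne (M := A.carrier) h),
    Submodule.mem_bot] at hA
  exact A.pullback_injective k (by rw [hA, map_zero])

/-- Expansion of a vector of `Λ_ℂ = ℂ²²` in the (integral) standard basis. [folklore] -/
theorem pi_eq_sum_single (z : K3Index → ℂ) :
    z = ∑ j, z j • fun i => ((Pi.single j (1 : ℤ) : K3Index → ℤ) i : ℂ) := by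
  classical
  funext i
  simp only [Finset.sum_apply, Pi.smul_apply, smul_eq_mul, Pi.single_apply, Int.cast_ite,
    Int.cast_one, Int.cast_zero, mul_ite, mul_one, mul_zero]
  rw [Finset.sum_ite_eq, if_pos (Finset.mem_univ i)]

/-- The standard basis vectors of `Λ_ℂ` are real. [folklore] -/
theorem star_single (j : K3Index) :
    star (fun i => ((Pi.single j (1 : ℤ) : K3Index → ℤ) i : ℂ)) =
      fun i => ((Pi.single j (1 : ℤ) : K3Index → ℤ) i : ℂ) := by
  funext i
  simp only [Pi.star_apply, star_intCast]

/-- A `ℂ`-linear endomorphism of `Λ_ℂ` defined over `ℚ` (it maps `Λ` into `Λ_ℚ`) maps `Λ_ℚ`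
into `Λ_ℚ`. [folklore] -/
theorem ratEnd_ratCast (ρ : Module.End ℂ (K3Index → ℂ))
    (hρ : ∀ v : K3Index → ℤ, ∃ w : K3Index → ℚ, ρ (fun i => (v i : ℂ)) = fun i => (w i : ℂ))
    (u : K3Index → ℚ) : ∃ w : K3Index → ℚ, ρ (fun i => (u i : ℂ)) = fun i => (w i : ℂ) := by
  obtain ⟨τ, hτ⟩ := exists_ratEnd_of_forall_intCast ρ hρ
  exact ⟨τ u, hτ u⟩

/-- Endomorphisms of `Λ_ℂ` defined over `ℚ` are stable under composition. [folklore] -/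
theorem ratEnd_mul (ρ₁ ρ₂ : Module.End ℂ (K3Index → ℂ))
    (h₁ : ∀ v : K3Index → ℤ, ∃ w : K3Index → ℚ, ρ₁ (fun i => (v i : ℂ)) = fun i => (w i : ℂ))
    (h₂ : ∀ v : K3Index → ℤ, ∃ w : K3Index → ℚ, ρ₂ (fun i => (v i : ℂ)) = fun i => (w i : ℂ))
    (v : K3Index → ℤ) : ∃ w : K3Index → ℚ, (ρ₁ * ρ₂) (fun i => (v i : ℂ)) = fun i => (w i : ℂ) := by
  obtain ⟨w₂, hw₂⟩ := h₂ v
  obtain ⟨w₁, hw₁⟩ := ratEnd_ratCast ρ₁ h₁ w₂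
  exact ⟨w₁, by rw [Module.End.mul_apply, hw₂, hw₁]⟩

/-- **An endomorphism of `Λ_ℂ` defined over `ℚ` is real**: it commutes with complex conjugation
of the coordinates. [folklore] -/
theorem ratEnd_star (ρ : Module.End ℂ (K3Index → ℂ))
    (hρ : ∀ v : K3Index → ℤ, ∃ w : K3Index → ℚ, ρ (fun i => (v i : ℂ)) = fun i => (w i : ℂ))
    (z : K3Index → ℂ) : ρ (star z) = star (ρ z) := by
  classical
  have hreal : ∀ j : K3Index,
      star (ρ fun i => ((Pi.single j (1 : ℤ) : K3Index → ℤ) i : ℂ)) =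
        ρ fun i => ((Pi.single j (1 : ℤ) : K3Index → ℤ) i : ℂ) := fun j => by
    obtain ⟨w, hw⟩ := hρ (Pi.single j 1)
    rw [hw]
    funext i
    simp only [Pi.star_apply, star_ratCast]
  have hsz : star z = ∑ j, star (z j) • fun i => ((Pi.single j (1 : ℤ) : K3Index → ℤ) i : ℂ) := by
    conv_lhs => rw [pi_eq_sum_single z]
    rw [star_sum]
    refine Finset.sum_congr rfl fun j _ => ?_
    rw [star_smul, star_single]
  conv_rhs => rw [pi_eq_sum_single z]
  rw [hsz, map_sum, map_sum, star_sum]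
  refine Finset.sum_congr rfl fun j _ => ?_
  rw [map_smul, map_smul, star_smul, hreal]

/-- **Markings are real**: under a marking `η : H²(S(ℂ); ℂ) ≅ Λ_ℂ` identifying the integral
classes with `Λ`, complex conjugation of classes is complex conjugation of coordinates,
`conj (η⁻¹ z) = η⁻¹ z̄` (the basis `η⁻¹ eⱼ` consists of integral, hence real, classes).
[cite: VoisinHodgeI2002, Cor. 6.12] -/
theorem conjClass_marking_symm {S : SchemeOver ℂ}
    (η : complexBetti S (2 * 1) ≃ₗ[ℂ] (K3Index → ℂ))
    (hη : ∀ c : complexBetti S (2 * 1), IsIntegralClass c ↔ ∃ v : K3Index → ℤ, η c = fun i => (v i : ℂ))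
    (z : K3Index → ℂ) :
    conjClass (ComplexPoints S) (2 * 1) (η.symm z) = η.symm (star z) := by
  classical
  have hint : ∀ j : K3Index,
      IsIntegralClass (η.symm fun i => ((Pi.single j (1 : ℤ) : K3Index → ℤ) i : ℂ)) := fun j =>
    (hη _).2 ⟨Pi.single j 1, η.apply_symm_apply _⟩
  have hsz : star z = ∑ j, star (z j) • fun i => ((Pi.single j (1 : ℤ) : K3Index → ℤ) i : ℂ) := by
    conv_lhs => rw [pi_eq_sum_single z]
    rw [star_sum]
    refine Finset.sum_congr rfl fun j _ => ?_
    rw [star_smul, star_single]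
  conv_lhs => rw [pi_eq_sum_single z]
  rw [hsz, map_sum, map_sum, ← conjClassEquiv_apply, map_sum]
  refine Finset.sum_congr rfl fun j _ => ?_
  rw [conjClassEquiv_apply, map_smul, map_smul, conjClass_smul,
    (hint j).isRationalClass.conjClass_eq, starRingEnd_apply]

/-- The integral generator of `H⁴` of a marked K3 surface is non-zero: `H⁴(S(ℂ); ℂ)` has a
non-zero integral class (`IsK3Surface.exists_isIntegralClass_generator_H4`), which is an integer
multiple of the generator. [cite: Huybrechts2016K3, Ch. 1 §3.2] -/
theorem generator_ne_zero {S : SchemeOver ℂ} (hS : IsK3Surface S) {p : complexBetti S (2 * 2)}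
    (hp : ∀ q : complexBetti S (2 * 2), IsIntegralClass q → ∃ n : ℤ, q = n • p) : p ≠ 0 := by
  obtain ⟨p₁, hp₁, hint, -⟩ := hS.exists_isIntegralClass_generator_H4
  obtain ⟨n, hn⟩ := hp p₁ hint
  rintro rfl
  rw [smul_zero] at hn
  exact hp₁ hn


/-! ### Local notation (the shape of `K3SurfaceProofs`, verbatim) -/

/-- `PeriodPt[x]`: `x ∈ Λ_ℂ` satisfies the hypotheses of `Huybrechts_K3_periodSurjective_projective`
(`(x.x) = 0`, `(x̄.x) > 0`, a positive lattice vector in `x^⊥`). Local notation only, copied from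
`K3SurfaceProofs`. -/
local notation3 (prettyPrint := false) "PeriodPt[" x "]" =>
  (k3Form x x = 0 ∧ 0 < (k3Form (star x) x).re ∧
    ∃ u : K3Index → ℤ, k3Form (fun i => (u i : ℂ)) x = 0 ∧ 0 < ∑ i, ∑ j, u i * k3Gram i j * u j)

/-! ### The map `η⁻¹ ∘ ρ ∘ η'` induced between marked K3 surfaces by a rational similitude `ρ` of `Λ_ℂ` -/

section MarkingConj

variable {S S' : SchemeOver ℂ}
  (η : complexBetti S (2 * 1) ≃ₗ[ℂ] (K3Index → ℂ)) (p : complexBetti S (2 * 2)) (x : K3Index → ℂ)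
  (η' : complexBetti S' (2 * 1) ≃ₗ[ℂ] (K3Index → ℂ)) (p' : complexBetti S' (2 * 2)) (x' : K3Index → ℂ)
  (ρ : Module.End ℂ (K3Index → ℂ))

/-- **`η⁻¹ ∘ ρ ∘ η'` is rational** when `ρ` is defined over `ℚ` and `η, η'` are markings of K3
surfaces (rational classes are exactly `Λ_ℚ` under a marking, `isRationalClass_iff_of_marking`).
[cite: Buskin2019, §6.2, proof of Thm. 1.1] -/
theorem isRationalClass_markingConj (hS : IsK3Surface S) (hS' : IsK3Surface S')
    (hη : ∀ c : complexBetti S (2 * 1), IsIntegralClass c ↔ ∃ v : K3Index → ℤ, η c = fun i => (v i : ℂ))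
    (hη' : ∀ c : complexBetti S' (2 * 1), IsIntegralClass c ↔ ∃ v : K3Index → ℤ, η' c = fun i => (v i : ℂ))
    (hρ : ∀ v : K3Index → ℤ, ∃ w : K3Index → ℚ, ρ (fun i => (v i : ℂ)) = fun i => (w i : ℂ))
    {y : complexBetti S' (2 * 1)} (hy : IsRationalClass y) :
    IsRationalClass (η.symm (ρ (η' y))) := by
  obtain ⟨w, hw⟩ := (isRationalClass_iff_of_marking hS' η' hη' y).1 hy
  obtain ⟨w', hw'⟩ := ratEnd_ratCast ρ hρ w
  exact (isRationalClass_iff_of_marking hS η hη _).2 ⟨w', by rw [η.apply_symm_apply, hw, hw']⟩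

/-- **`η⁻¹ ∘ ρ ∘ η'` multiplies the cup product by `r`** when `ρ` multiplies the K3 form by `r`
(generators `p, p'` of `H⁴` of the two markings; `p' ≠ 0` so that the multiplier `a` in
`y ∪ z = a p'` is determined). [cite: Buskin2019, §6.2, proof of Thm. 1.1] -/
theorem cupProduct_markingConj (hp' : p' ≠ 0)
    (hηcup : ∀ a b : complexBetti S (2 * 1),
      cupProduct (rfl : 2 * 1 + 2 * 1 = 2 * 2) a b = k3Form (η a) (η b) • p)
    (hη'cup : ∀ a b : complexBetti S' (2 * 1),
      cupProduct (rfl : 2 * 1 + 2 * 1 = 2 * 2) a b = k3Form (η' a) (η' b) • p')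
    {r : ℂ} (hρ : ∀ a b, k3Form (ρ a) (ρ b) = r * k3Form a b)
    (y z : complexBetti S' (2 * 1)) (a : ℂ)
    (h : cupProduct (rfl : 2 * 1 + 2 * 1 = 2 * 2) y z = a • p') :
    cupProduct (rfl : 2 * 1 + 2 * 1 = 2 * 2) (η.symm (ρ (η' y))) (η.symm (ρ (η' z))) = (r * a) • p := by
  rw [hηcup, η.apply_symm_apply, η.apply_symm_apply, hρ]
  rw [hη'cup] at h
  have h1 := sub_eq_zero.2 h
  rw [← sub_smul, smul_eq_zero, sub_eq_zero] at h1
  rcases h1 with h1 | h1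
  · rw [h1]
  · exact absurd h1 hp'

/-- A vector with `(x̄.x) ≠ 0` (e.g. a period point, `re (x̄.x) > 0`) is non-zero. [folklore] -/
theorem ne_zero_of_star_self_re_pos {x : K3Index → ℂ} (hx : 0 < (k3Form (star x) x).re) : x ≠ 0 := by
  rintro rfl
  simp [k3Form] at hx

/-- **`η⁻¹ ∘ ρ ∘ η'` preserves every Hodge type** when `ρ` is a rational similitude of `Λ_ℂ` of
non-zero multiplier carrying the period of `(S', η')` into the period line of `(S, η)`: the types
`(i, j)` with `i + j ≠ 2` carry only `0`; `H^{2,0} = ℂσ` goes to `ℂσ` by the period condition;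
`H^{0,2} = ℂσ̄` goes to `ℂσ̄` because markings and `ρ` are real; and `H^{1,1} = ⟨σ, σ̄⟩^⊥` goes to
`⟨σ, σ̄⟩^⊥` because `ρ` preserves orthogonality (Huybrechts Ch. 6 Prop. 1.2: the Hodge structure of
K3 type is determined by its `(2,0)`-line; the tree's named fact `Huybrechts_K3_hodgeTypes_H2`).
[cite: Huybrechts2016K3, Ch. 6 Prop. 1.2 and Example 1.3 (i)] [cite: Buskin2019, §6.2, proof of Thm. 1.1] -/
theorem isOfHodgeType_markingConj (hHT : Huybrechts_K3_hodgeTypes_H2)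
    (hS : IsK3Surface S) (hS' : IsK3Surface S')
    (hη : ∀ c : complexBetti S (2 * 1), IsIntegralClass c ↔ ∃ v : K3Index → ℤ, η c = fun i => (v i : ℂ))
    (hηcup : ∀ a b : complexBetti S (2 * 1),
      cupProduct (rfl : 2 * 1 + 2 * 1 = 2 * 2) a b = k3Form (η a) (η b) • p)
    (h20 : IsOfHodgeType 2 S (2 * 1) 2 0 (η.symm x)) (hx : 0 < (k3Form (star x) x).re)
    (hη' : ∀ c : complexBetti S' (2 * 1), IsIntegralClass c ↔ ∃ v : K3Index → ℤ, η' c = fun i => (v i : ℂ))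
    (hη'cup : ∀ a b : complexBetti S' (2 * 1),
      cupProduct (rfl : 2 * 1 + 2 * 1 = 2 * 2) a b = k3Form (η' a) (η' b) • p')
    (hp' : p' ≠ 0)
    (h20' : IsOfHodgeType 2 S' (2 * 1) 2 0 (η'.symm x')) (hx' : 0 < (k3Form (star x') x').re)
    (hρrat : ∀ v : K3Index → ℤ, ∃ w : K3Index → ℚ, ρ (fun i => (v i : ℂ)) = fun i => (w i : ℂ))
    {r : ℂ} (hr : r ≠ 0) (hρ : ∀ a b, k3Form (ρ a) (ρ b) = r * k3Form a b)
    (hper : ∃ t : ℂ, ρ x' = t • x) :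
    ∀ (i j : ℕ) (y : complexBetti S' (2 * 1)),
      IsOfHodgeType 2 S' (2 * 1) i j y → IsOfHodgeType 2 S (2 * 1) i j (η.symm (ρ (η' y))) := by
  -- the two `(2,0)`-classes and the period condition
  have hσ0 : η.symm x ≠ 0 := fun h0 => ne_zero_of_star_self_re_pos hx (by simpa using congrArg η h0)
  have hσ'0 : η'.symm x' ≠ 0 := fun h0 => ne_zero_of_star_self_re_pos hx' (by simpa using congrArg η' h0)
  obtain ⟨t, ht⟩ := hper
  have ht0 : t ≠ 0 := by
    rintro rfl
    rw [zero_smul] at ht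
    have h1 := hρ (star x') x'
    rw [ht, k3Form_zero_right] at h1
    have h2 : k3Form (star x') x' = 0 := by
      rcases mul_eq_zero.1 h1.symm with h | h
      · exact absurd h hr
      · exact h
    rw [h2, Complex.zero_re] at hx'
    exact lt_irrefl _ hx'
  have hxt : x = t⁻¹ • ρ x' := by rw [ht, smul_smul, inv_mul_cancel₀ ht0, one_smul]
  obtain ⟨h1, h2, h3⟩ := hHT S hS (η.symm x) h20 hσ0
  obtain ⟨h1', h2', h3'⟩ := hHT S' hS' (η'.symm x') h20' hσ'0
  intro i j y hy
  by_cases hij : i + j = 2 * 1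
  · obtain ⟨rfl, rfl⟩ | ⟨rfl, rfl⟩ | ⟨rfl, rfl⟩ :
        (i = 2 ∧ j = 0) ∨ (i = 0 ∧ j = 2) ∨ (i = 1 ∧ j = 1) := by omega
    · -- type `(2,0)`: the period line goes to the period line
      obtain ⟨t', rfl⟩ := (h1' y).1 hy
      refine (h1 _).2 ⟨t' * t, ?_⟩
      rw [map_smul, LinearEquiv.apply_symm_apply, map_smul, ht, map_smul, map_smul, smul_smul]
    · -- type `(0,2)`: conjugates of the period lines, by reality of `η, η', ρ`
      obtain ⟨t', rfl⟩ := (h2' y).1 hy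
      refine (h2 _).2 ⟨t' * star t, ?_⟩
      rw [map_smul, conjClass_marking_symm η' hη', LinearEquiv.apply_symm_apply, map_smul,
        ratEnd_star ρ hρrat, ht, star_smul, map_smul, map_smul, ← conjClass_marking_symm η hη,
        smul_smul]
    · -- type `(1,1)`: orthogonality to `σ, σ̄` is preserved
      obtain ⟨hc1, hc2⟩ := (h3' y).1 hy
      have hk1 : k3Form (η' y) x' = 0 := by
        rw [hη'cup, LinearEquiv.apply_symm_apply, smul_eq_zero] at hc1
        exact hc1.resolve_right hp'
      have hk2 : k3Form (η' y) (star x') = 0 := by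
        rw [conjClass_marking_symm η' hη', hη'cup, LinearEquiv.apply_symm_apply, smul_eq_zero] at hc2
        exact hc2.resolve_right hp'
      refine (h3 _).2 ⟨?_, ?_⟩
      · rw [hηcup, LinearEquiv.apply_symm_apply, LinearEquiv.apply_symm_apply, hxt,
          k3Form_smul_right, hρ, hk1, mul_zero, mul_zero, zero_smul]
      · rw [conjClass_marking_symm η hη, hηcup, LinearEquiv.apply_symm_apply,
          LinearEquiv.apply_symm_apply, hxt, star_smul, ← ratEnd_star ρ hρrat, k3Form_smul_right,
          hρ, hk2, mul_zero, mul_zero, zero_smul]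
  · -- types `(i, j)` with `i + j ≠ 2` carry only the zero class
    obtain rfl := isOfHodgeType_eq_zero_of_add_ne hy hij
    rw [map_zero, map_zero, map_zero]
    obtain ⟨A⟩ := hS.nonempty_hodgeModel
    exact IsOfHodgeType.zero A _ _ _

end MarkingConj

/-! ### Periods of twins: the hypotheses of the surjectivity fact pass through a rational `½`-similitude -/

/-- **The period `N x` of the twin is a projective period point.** If `x` satisfies the hypotheses
of `Huybrechts_K3_periodSurjective_projective` and `N` is an endomorphism of `Λ_ℂ` defined over `ℚ`
with `(Na.Nb) = ½ (a.b)` (the inverse of an integral `2`-similitude), then so does `N x`: `N` is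
real, and a positive lattice vector `u ∈ x^⊥` goes to the positive rational vector `N u ∈ (N x)^⊥`,
a multiple of which lies in `Λ` (`exists_lattice_pos_orthogonal`). This is why the twin of a
PROJECTIVE K3 surface is projective. [cite: Huybrechts2016K3, Ch. 6 Rem. 3.3 and Ch. 1 §3 (projectivity criterion)] -/
theorem periodPt_twin (N : Module.End ℂ (K3Index → ℂ))
    (hNrat : ∀ v : K3Index → ℤ, ∃ w : K3Index → ℚ, N (fun i => (v i : ℂ)) = fun i => (w i : ℂ))
    (hN : ∀ a b, k3Form (N a) (N b) = (2 : ℂ)⁻¹ * k3Form a b) {x : K3Index → ℂ}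
    (hx : PeriodPt[x]) : PeriodPt[N x] := by
  obtain ⟨hxx, hpos, u, hux, huu⟩ := hx
  refine ⟨by rw [hN, hxx, mul_zero], ?_, ?_⟩
  · rw [← ratEnd_star N hNrat x, hN, show (2 : ℂ)⁻¹ = ((2⁻¹ : ℝ) : ℂ) by norm_num,
      Complex.re_ofReal_mul]
    positivity
  · obtain ⟨w, hw⟩ := hNrat u
    refine exists_lattice_pos_orthogonal (n := w) ?_ ?_
    · rw [← hw, hN, hux, mul_zero]
    · have h1 : ((k3FormRat w w : ℚ) : ℂ) =
          (((∑ i, ∑ j, u i * k3Gram i j * u j : ℤ) : ℚ) / 2 : ℚ) := by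
        rw [← k3Form_ratCast, ← hw, hN, k3Form_intCast]
        push_cast
        ring
      have h2 : k3FormRat w w = ((∑ i, ∑ j, u i * k3Gram i j * u j : ℤ) : ℚ) / 2 :=
        Rat.cast_injective h1
      rw [h2]
      exact div_pos (Int.cast_pos.2 huu) two_pos

/-! ### The similitude induced via markings, with signs and a multiplier -/

/-- **The similitude induced via markings, with signs and multiplier `r`.** As
`k3Form_markingConj_signed` (`K3SurfaceProofs`), for a map `φ` multiplying cup products by `r`
(`(x.y) = a p' ⟹ (φx.φy) = (r a) p`): with the generators of `H⁴` used by the markings (`p₀`,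
`p₀'`) and by the similitude hypothesis (`p`, `p'`) differing by signs `s`, `s'`, the conjugate
`σ = η ∘ φ ∘ η'⁻¹` multiplies the K3 form by `s' s r`. [cite: Buskin2019, §6.2, proof of Thm. 1.1] -/
theorem k3Form_markingConj_signed_mul {S S' : SchemeOver ℂ}
    (η : complexBetti S (2 * 1) ≃ₗ[ℂ] (K3Index → ℂ))
    (p₀ p : complexBetti S (2 * 2)) (hp₀ : p₀ ≠ 0) (s : ℂ) (hs : p = s • p₀)
    (hηcup : ∀ a b : complexBetti S (2 * 1),
      cupProduct (rfl : 2 * 1 + 2 * 1 = 2 * 2) a b = k3Form (η a) (η b) • p₀)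
    (η' : complexBetti S' (2 * 1) ≃ₗ[ℂ] (K3Index → ℂ))
    (p₀' p' : complexBetti S' (2 * 2)) (s' : ℂ) (hs' : p₀' = s' • p')
    (hη'cup : ∀ a b : complexBetti S' (2 * 1),
      cupProduct (rfl : 2 * 1 + 2 * 1 = 2 * 2) a b = k3Form (η' a) (η' b) • p₀')
    (r : ℂ) (φ : complexBetti S' (2 * 1) →ₗ[ℂ] complexBetti S (2 * 1))
    (hφ : ∀ (x y : complexBetti S' (2 * 1)) (a : ℂ),
      cupProduct (rfl : 2 * 1 + 2 * 1 = 2 * 2) x y = a • p' →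
        cupProduct (rfl : 2 * 1 + 2 * 1 = 2 * 2) (φ x) (φ y) = (r * a) • p)
    (a b : K3Index → ℂ) :
    k3Form ((η.toLinearMap ∘ₗ φ ∘ₗ η'.symm.toLinearMap) a)
      ((η.toLinearMap ∘ₗ φ ∘ₗ η'.symm.toLinearMap) b) = s' * s * r * k3Form a b := by
  have h1 : cupProduct (rfl : 2 * 1 + 2 * 1 = 2 * 2) (η'.symm a) (η'.symm b) =
      (k3Form a b * s') • p' := by
    rw [hη'cup, η'.apply_symm_apply, η'.apply_symm_apply, hs', smul_smul]
  have h2 := hφ _ _ _ h1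
  rw [hηcup, hs, smul_smul] at h2
  have h3 := sub_eq_zero.2 h2
  rw [← sub_smul, smul_eq_zero, sub_eq_zero] at h3
  rcases h3 with h3 | h3
  · simp only [LinearMap.coe_comp, LinearEquiv.coe_coe, Function.comp_apply]
    rw [h3]
    ring
  · exact absurd h3 hp₀

end Summit.HodgeConjecture.HodgeConjecture.Theorems.NikulinTwinTransport

end
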